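import Summits.KontsevichZagierPeriods.Zeta5Search.RVPeriodicWindows
import Summits.KontsevichZagierPeriods.Zeta5Search.Certificates.RayC1KernelPeriodicClass
import HarnessLib

/-!
# ζ(5) search — certificates: periodic class cells as LOW-KIND windows (shifts 1–3) and the round checkers' glue (TYPER g18)

HONEST FRAMING: systematic search; no irrationality claim unless certified.  Bookkeeping of window theorems; nothing about
`ζ(5)`; every exponent this feeds is `< 1` (calibration ladder of the T1-map ray C1; λ* = 108.2193 is the certified tie; no
crossing claimed).

OUR work (Summit side; typer seat, generation 18).  The θ ≤ 1 PERIODIC consumption rounds (`RayC1KernelClassR8`, …) feed cert-1 g6's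
`RayC1KernelPeriodic.c1_exponent_of_tables` with a WINDOW table above `θ = 1/4` and a PERIODIC table below it.  A landed periodic class
cell (`RVPeriodicWindows.PWin`, `PWin.Holds`: one Casoratian floor `B₁ − 256·m` for EVERY shift `m ≥ 1`) is used twice:
* at the shifts `m = 1, 2, 3` (`θ ∈ (1/4, 1)`) as a kind-4 window of typer g17's `RayC1KernelClassLowKind` — exact prime-number-theorem
  rates in the window table: `cwlOfPW pw` lists `c.win 1, c.win 2, c.win 3` for every `c ∈ pw` (index `3·j + (m − 1)`), and
  **`cwlOfPW_holdsLow`** derives `∀ w ∈ cwlOfPW pw, w.HoldsLow` from `∀ c ∈ pw, c.Holds` (fam-rv g17's `PWin.holdsLow_win`);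
* at every shift `m ≥ 4` inside the periodic table (`RayC1KernelPeriodicClass.pClassCond pw 1`, digamma minorant `pterm 4`, loss < 0.2 %).
Glue for round files: `pw_holds_append` (cell lists are concatenated BY NAME from the landed `pwList<k>`).
-/

namespace Summit.KontsevichZagierPeriods.Zeta5Search.RayC1

open Summit.KontsevichZagierPeriods.Zeta5Search.RayKernel
open Summit.KontsevichZagierPeriods.Zeta5Search.RVPeriodic (PWin)

/-- **The kind-4 windows of a periodic cell list**: the shifts `m = 1, 2, 3` of every cell (`PWin.win`), cell-major (index `3·j + (m − 1)`). -/
def cwlOfPW (pw : List PWin) : List CWin := pw.flatMap fun c => [c.win 1, c.win 2, c.win 3]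

/-- **Every derived low window holds** when every cell holds (and every cell has `v₁ ≤ v₂`, a decidable side condition). -/
theorem cwlOfPW_holdsLow {pw : List PWin} (hpw : ∀ c ∈ pw, c.Holds) (hv : (pw.all fun c => decide (c.v1 ≤ c.v2)) = true) :
    ∀ w ∈ cwlOfPW pw, w.HoldsLow := by
  intro w hw
  rw [cwlOfPW, List.mem_flatMap] at hw
  obtain ⟨c, hc, hw⟩ := hw
  have hv' : c.v1 ≤ c.v2 := by
    rw [List.all_eq_true] at hv
    exact of_decide_eq_true (hv c hc)
  have h := hpw c hc
  simp only [List.mem_cons, List.not_mem_nil, or_false] at hw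
  rcases hw with rfl | rfl | rfl
  · exact PWin.holdsLow_win c hv' h (by norm_num)
  · exact PWin.holdsLow_win c hv' h (by norm_num)
  · exact PWin.holdsLow_win c hv' h (by norm_num)

/-- `Holds` on a concatenation of cell lists. -/
theorem pw_holds_append {l₁ l₂ : List PWin} (h₁ : ∀ c ∈ l₁, c.Holds) (h₂ : ∀ c ∈ l₂, c.Holds) : ∀ c ∈ l₁ ++ l₂, c.Holds :=
  List.forall_mem_append.2 ⟨h₁, h₂⟩

end Summit.KontsevichZagierPeriods.Zeta5Search.RayC1
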